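import Summits.QuantumFields.QCD.Theorems.PauliWegnerSeaChiralOneScaleTrajectoryJensenBridge

/-!
# Pointwise Jensen inequality and the per-rate Jensen bridge (line `Sketch`, crux
`PauliWegnerSea.ChiralOneScaleTrajectory`, stmt-QuantumFields-17512)

* `fm_rpow_le_secondMoment_two` — at `N_f = 2`, a degenerate bare mass `t`, ANY torus, coupling, flavour
  and pair of sites: `(E₊[X^s])^{2/s} ≤ 144 · E₊[Σ |G_f|²]` for `0 < s ≤ 2`, `X = Σ_{a,i,b,j}|G_f((x,a,i),(y,b,j))|`,
  `E₊` the `|det|`-weighted (phase-quenched) quotient (Cauchy–Schwarz over the `144` pairs + Jensen under the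
  phase-quenched probability measure; the filter-free core of `unsignedPin_two_of_fmPin`).
* `unsignedPin_two_of_fmPin_var` — the per-rate form of the Jensen bridge: for each rate `ε` its OWN
  exponent `s(ε) ∈ (0,2]` and mass `m(ε)` with a frequently-violated certificate for `E₊[X^s]` at rate
  `sε/2` suffice for the unsigned second-moment pin (the form fed by clause (iii), whose exponent depends on
  the tuple).
Folklore.
-/

noncomputable section

namespace Summit.QuantumFields.QCD.Cruxes.ChiralOneScaleTrajectory.GoldstoneWitness

open scoped BigOperators
open MeasureTheory Filter
open Literature.MathematicalPhysics.QuantumFieldTheory Literature.MathematicalPhysics.QuantumLattice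
  Literature.Probability.LatticeModels

/-- **Pointwise Jensen at `N_f = 2`**: `(E₊[X^s])^{2/s} ≤ 144 · E₊[Σ|G_f|²]` (see the module docstring). -/
theorem fm_rpow_le_secondMoment_two :
    ∀ (L : ℕ) [NeZero L] (β t s : ℝ), 0 < s → s ≤ 2 → ∀ (f : Fin 2) (x y : TorusSite 4 L), ((∫ U : GaugeConfig 4 L (Matrix.specialUnitaryGroup (Fin 3) ℂ), ‖(diracMatrix U fun _ : Fin 2 => t).det‖ * (∑ a : Fin 3, ∑ i : Fin 4, ∑ b : Fin 3, ∑ j : Fin 4, ‖(diracMatrix U fun _ : Fin 2 => t)⁻¹ (quarkEquiv (f, (x, a, i))) (quarkEquiv (f, (y, b, j)))‖) ^ s ∂(wilsonMeasure (fundamentalRep (Fin 3)) β)) / (∫ U : GaugeConfig 4 L (Matrix.specialUnitaryGroup (Fin 3) ℂ), ‖(diracMatrix U fun _ : Fin 2 => t).det‖ ∂(wilsonMeasure (fundamentalRep (Fin 3)) β))) ^ (2 / s) ≤ 144 * ((∫ U : GaugeConfig 4 L (Matrix.specialUnitaryGroup (Fin 3) ℂ), ‖(diracMatrix U fun _ :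 Fin 2 => t).det‖ * (∑ a : Fin 3, ∑ i : Fin 4, ∑ b : Fin 3, ∑ j : Fin 4, ‖(diracMatrix U fun _ : Fin 2 => t)⁻¹ (quarkEquiv (f, (x, a, i))) (quarkEquiv (f, (y, b, j)))‖ ^ (2 : ℕ)) ∂(wilsonMeasure (fundamentalRep (Fin 3)) β)) / (∫ U : GaugeConfig 4 L (Matrix.specialUnitaryGroup (Fin 3) ℂ), ‖(diracMatrix U fun _ : Fin 2 => t).det‖ ∂(wilsonMeasure (fundamentalRep (Fin 3)) β))) := by
  intro L _ β t s hs hs2 f x y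
  set mq : Fin 2 → ℝ := fun _ => t with hmq
  set μ := wilsonMeasure (d := 4) (L := L) (fundamentalRep (Fin 3)) β with hμ
  haveI : IsProbabilityMeasure μ := isProbabilityMeasure_wilsonMeasure _ (continuous_fundamentalRep _) _
  set P : Fin 3 → Fin 4 → FermiIdx 2 L := fun a i => quarkEquiv (f, (x, a, i)) with hP
  set Q : Fin 3 → Fin 4 → FermiIdx 2 L := fun b j => quarkEquiv (f, (y, b, j)) with hQ
  set G : GaugeConfig 4 L SU3 → Fin 3 → Fin 4 → Fin 3 → Fin 4 → ℝ :=
    fun U a i b j => ‖(diracMatrix U mq)⁻¹ (P a i) (Q b j)‖ with hG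
  set Y : GaugeConfig 4 L SU3 → ℝ := fun U =>
    ∑ a : Fin 3, ∑ i : Fin 4, ∑ b : Fin 3, ∑ j : Fin 4, G U a i b j with hY
  set Y2 : GaugeConfig 4 L SU3 → ℝ := fun U =>
    ∑ a : Fin 3, ∑ i : Fin 4, ∑ b : Fin 3, ∑ j : Fin 4, G U a i b j ^ 2 with hY2
  have hG0 : ∀ U a i b j, 0 ≤ G U a i b j := fun U a i b j => norm_nonneg _
  have hY0 : ∀ U, 0 ≤ Y U := fun U => Finset.sum_nonneg fun a _ => Finset.sum_nonneg fun i _ =>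
    Finset.sum_nonneg fun b _ => Finset.sum_nonneg fun j _ => hG0 U a i b j
  have hY20 : ∀ U, 0 ≤ Y2 U := fun U => Finset.sum_nonneg fun a _ => Finset.sum_nonneg fun i _ =>
    Finset.sum_nonneg fun b _ => Finset.sum_nonneg fun j _ => sq_nonneg _
  have hGm : ∀ a i b j, Measurable fun U => G U a i b j := fun a i b j =>
    (measurable_inv_diracMatrix_apply mq (P a i) (Q b j)).norm
  have hYm : Measurable Y := Finset.measurable_sum _ fun a _ => Finset.measurable_sum _ fun i _ =>
    Finset.measurable_sum _ fun b _ => Finset.measurable_sum _ fun j _ => hGm a i b j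
  have hY2m : Measurable Y2 := Finset.measurable_sum _ fun a _ => Finset.measurable_sum _ fun i _ =>
    Finset.measurable_sum _ fun b _ => Finset.measurable_sum _ fun j _ => (hGm a i b j).pow_const 2
  -- the uniform weight bound `|det D| · G² ≤ B`
  have hc : Continuous fun U : GaugeConfig 4 L SU3 => wilsonDirac (fundamentalRep (Fin 3)) U t 1 :=
    continuous_wilsonDirac _ (continuous_fundamentalRep (Fin 3)) t 1
  obtain ⟨B, hB⟩ : ∃ B : ℝ, ∀ (U : GaugeConfig 4 L SU3) a i b j,
      ‖(diracMatrix U mq).det‖ * G U a i b j ^ 2 ≤ B := by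
    have hcont : Continuous fun U : GaugeConfig 4 L SU3 =>
        ∑ a : Fin 3, ∑ i : Fin 4, ∑ b : Fin 3, ∑ j : Fin 4,
          ‖(wilsonDirac (fundamentalRep (Fin 3)) U t 1).adjugate (x, a, i) (y, b, j)‖ ^ 2 := by
      refine continuous_finsetSum _ fun a _ => continuous_finsetSum _ fun i _ =>
        continuous_finsetSum _ fun b _ => continuous_finsetSum _ fun j _ => ?_
      exact ((hc.matrix_adjugate.matrix_elem _ _).norm).pow 2
    obtain ⟨U₀, -, hU₀⟩ := (isCompact_univ (X := GaugeConfig 4 L SU3)).exists_isMaxOn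
      Set.univ_nonempty hcont.continuousOn
    refine ⟨∑ a : Fin 3, ∑ i : Fin 4, ∑ b : Fin 3, ∑ j : Fin 4,
        ‖(wilsonDirac (fundamentalRep (Fin 3)) U₀ t 1).adjugate (x, a, i) (y, b, j)‖ ^ 2, fun U a i b j => ?_⟩
    refine (norm_det_mul_normSq_inv_le_two U t f _ _).trans ((?_ : _ ≤ _).trans (hU₀ (Set.mem_univ U)))
    have h1 : ∀ a' i' b' j', 0 ≤ ‖(wilsonDirac (fundamentalRep (Fin 3)) U t 1).adjugate
        (x, a', i') (y, b', j')‖ ^ 2 := fun _ _ _ _ => sq_nonneg _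
    calc ‖(wilsonDirac (fundamentalRep (Fin 3)) U t 1).adjugate (x, a, i) (y, b, j)‖ ^ 2
        ≤ ∑ j' : Fin 4, ‖(wilsonDirac (fundamentalRep (Fin 3)) U t 1).adjugate (x, a, i) (y, b, j')‖ ^ 2 :=
          Finset.single_le_sum (fun j' _ => h1 a i b j') (Finset.mem_univ j)
      _ ≤ ∑ b' : Fin 3, ∑ j' : Fin 4, ‖(wilsonDirac (fundamentalRep (Fin 3)) U t 1).adjugate
            (x, a, i) (y, b', j')‖ ^ 2 :=
          Finset.single_le_sum (fun b' _ => Finset.sum_nonneg fun j' _ => h1 a i b' j') (Finset.mem_univ b)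
      _ ≤ ∑ i' : Fin 4, ∑ b' : Fin 3, ∑ j' : Fin 4, ‖(wilsonDirac (fundamentalRep (Fin 3)) U t 1).adjugate
            (x, a, i') (y, b', j')‖ ^ 2 :=
          Finset.single_le_sum (fun i' _ => Finset.sum_nonneg fun b' _ => Finset.sum_nonneg fun j' _ =>
            h1 a i' b' j') (Finset.mem_univ i)
      _ ≤ ∑ a' : Fin 3, ∑ i' : Fin 4, ∑ b' : Fin 3, ∑ j' : Fin 4,
            ‖(wilsonDirac (fundamentalRep (Fin 3)) U t 1).adjugate (x, a', i') (y, b', j')‖ ^ 2 :=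
          Finset.single_le_sum (fun a' _ => Finset.sum_nonneg fun i' _ => Finset.sum_nonneg fun b' _ =>
            Finset.sum_nonneg fun j' _ => h1 a' i' b' j') (Finset.mem_univ a)
  -- weight bounds for `Y2`, `Y ^ 2` and `Y ^ s`
  have hwY2 : ∀ U, ‖(diracMatrix U mq).det‖ * Y2 U ≤ 144 * B := by
    intro U
    have : ‖(diracMatrix U mq).det‖ * Y2 U =
        ∑ a : Fin 3, ∑ i : Fin 4, ∑ b : Fin 3, ∑ j : Fin 4, ‖(diracMatrix U mq).det‖ * G U a i b j ^ 2 := by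
      simp only [hY2, Finset.mul_sum]
    rw [this]
    calc ∑ a : Fin 3, ∑ i : Fin 4, ∑ b : Fin 3, ∑ j : Fin 4, ‖(diracMatrix U mq).det‖ * G U a i b j ^ 2
        ≤ ∑ _a : Fin 3, ∑ _i : Fin 4, ∑ _b : Fin 3, ∑ _j : Fin 4, B :=
          Finset.sum_le_sum fun a _ => Finset.sum_le_sum fun i _ => Finset.sum_le_sum fun b _ =>
            Finset.sum_le_sum fun j _ => hB U a i b j
      _ = 144 * B := by simp; ring
  have hYsq : ∀ U, Y U ^ 2 ≤ 144 * Y2 U := fun U => sq_sum_four_le (G U)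
  have hwYsq : ∀ U, ‖(diracMatrix U mq).det‖ * Y U ^ 2 ≤ 144 * (144 * B) := fun U =>
    calc ‖(diracMatrix U mq).det‖ * Y U ^ 2 ≤ ‖(diracMatrix U mq).det‖ * (144 * Y2 U) :=
          mul_le_mul_of_nonneg_left (hYsq U) (norm_nonneg _)
      _ = 144 * (‖(diracMatrix U mq).det‖ * Y2 U) := by ring
      _ ≤ 144 * (144 * B) := by nlinarith [hwY2 U]
  obtain ⟨Bd, hBd⟩ := exists_norm_det_diracMatrix_le (S := L) mq
  have hwYs : ∀ U, ‖(diracMatrix U mq).det‖ * Y U ^ s ≤ Bd + 144 * (144 * B) := fun U =>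
    calc ‖(diracMatrix U mq).det‖ * Y U ^ s ≤ ‖(diracMatrix U mq).det‖ * (1 + Y U ^ 2) :=
          mul_le_mul_of_nonneg_left (rpow_le_one_add_sq (hY0 U) hs hs2) (norm_nonneg _)
      _ = ‖(diracMatrix U mq).det‖ + ‖(diracMatrix U mq).det‖ * Y U ^ 2 := by ring
      _ ≤ Bd + 144 * (144 * B) := add_le_add (hBd U) (hwYsq U)
  -- integrability
  have hiYs : Integrable (fun U => Y U ^ s) (qcdLatticeMeasure L β mq) :=
    integrable_qcdLatticeMeasure_of_weight_bound β mq _ (hYm.pow_const s) _ fun U => by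
      rw [Real.norm_eq_abs, abs_of_nonneg (Real.rpow_nonneg (hY0 U) s)]; exact hwYs U
  have hiY2r : Integrable (fun U => Y U ^ (2 : ℝ)) (qcdLatticeMeasure L β mq) := by
    simp_rw [Real.rpow_two]
    exact integrable_qcdLatticeMeasure_of_weight_bound β mq _ (hYm.pow_const 2) _ fun U => by
      rw [Real.norm_eq_abs, abs_of_nonneg (sq_nonneg _)]; exact hwYsq U
  have hdm := measurable_norm_det_diracMatrix (S := L) mq
  have hiwYsq : Integrable (fun U => ‖(diracMatrix U mq).det‖ * Y U ^ (2 : ℝ)) μ := by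
    simp_rw [Real.rpow_two]
    refine Integrable.of_bound (hdm.mul (hYm.pow_const 2)).aestronglyMeasurable (144 * (144 * B))
      (Eventually.of_forall fun U => ?_)
    rw [Real.norm_eq_abs, abs_of_nonneg (mul_nonneg (norm_nonneg _) (sq_nonneg _))]
    exact hwYsq U
  have hiwY2 : Integrable (fun U => ‖(diracMatrix U mq).det‖ * (144 * Y2 U)) μ := by
    refine Integrable.of_bound (hdm.mul (hY2m.const_mul 144)).aestronglyMeasurable (144 * (144 * B))
      (Eventually.of_forall fun U => ?_)
    rw [Real.norm_eq_abs, abs_of_nonneg (mul_nonneg (norm_nonneg _) (by nlinarith [hY20 U]))]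
    calc ‖(diracMatrix U mq).det‖ * (144 * Y2 U) = 144 * (‖(diracMatrix U mq).det‖ * Y2 U) := by ring
      _ ≤ 144 * (144 * B) := by nlinarith [hwY2 U]
  -- Jensen and Cauchy–Schwarz in phase-quenched form
  have hZ := integral_norm_det_diracMatrix_pos_all (S := L) β mq
  have hJ : qcdPhaseQuenchedExpect β L mq (fun U => Y U ^ s) ≤
      (qcdPhaseQuenchedExpect β L mq (fun U => Y U ^ (2 : ℝ))) ^ (s / 2) :=
    qcdPhaseQuenchedExpect_rpow_le_rpow β mq hZ Y hY0 hs hs2 hiYs hiY2r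
  have hCS : qcdPhaseQuenchedExpect β L mq (fun U => Y U ^ (2 : ℝ)) ≤
      qcdPhaseQuenchedExpect β L mq (fun U => 144 * Y2 U) :=
    qcdPhaseQuenchedExpect_mono β mq _ _ hiwYsq hiwY2 (Eventually.of_forall fun U => by
      rw [Real.rpow_two]; exact hYsq U)
  have hlin : qcdPhaseQuenchedExpect β L mq (fun U => 144 * Y2 U) = 144 * qcdPhaseQuenchedExpect β L mq Y2 := by
    have := qcdPhaseQuenchedExpect_smul β mq (144 : ℝ) Y2
    simp only [smul_eq_mul] at this
    exact this
  have hq2 : 0 ≤ qcdPhaseQuenchedExpect β L mq (fun U => Y U ^ (2 : ℝ)) := by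
    rw [qcdPhaseQuenchedExpect_eq_div]
    exact div_nonneg (integral_nonneg fun U => mul_nonneg (norm_nonneg _) (Real.rpow_nonneg (hY0 U) _))
      (integral_nonneg fun U => norm_nonneg _)
  have hqs : 0 ≤ qcdPhaseQuenchedExpect β L mq (fun U => Y U ^ s) := by
    rw [qcdPhaseQuenchedExpect_eq_div]
    exact div_nonneg (integral_nonneg fun U => mul_nonneg (norm_nonneg _) (Real.rpow_nonneg (hY0 U) _))
      (integral_nonneg fun U => norm_nonneg _)
  have hFM : (∫ U, ‖(diracMatrix U mq).det‖ * Y U ^ s ∂μ) / (∫ U, ‖(diracMatrix U mq).det‖ ∂μ) =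
      qcdPhaseQuenchedExpect β L mq (fun U => Y U ^ s) :=
    (qcdPhaseQuenchedExpect_eq_div β mq _).symm
  have hQ2 : (∫ U, ‖(diracMatrix U mq).det‖ * Y2 U ∂μ) / (∫ U, ‖(diracMatrix U mq).det‖ ∂μ) =
      qcdPhaseQuenchedExpect β L mq Y2 :=
    (qcdPhaseQuenchedExpect_eq_div β mq _).symm
  change ((∫ U, ‖(diracMatrix U mq).det‖ * Y U ^ s ∂μ) / (∫ U, ‖(diracMatrix U mq).det‖ ∂μ)) ^ (2 / s) ≤
    144 * ((∫ U, ‖(diracMatrix U mq).det‖ * Y2 U ∂μ) / (∫ U, ‖(diracMatrix U mq).det‖ ∂μ))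
  rw [hFM, hQ2]
  have h2s : 0 < 2 / s := by positivity
  -- `(E Y^s)^{2/s} ≤ ((E Y²)^{s/2})^{2/s} = E Y² ≤ 144 E Y2`
  calc (qcdPhaseQuenchedExpect β L mq (fun U => Y U ^ s)) ^ (2 / s)
      ≤ ((qcdPhaseQuenchedExpect β L mq (fun U => Y U ^ (2 : ℝ))) ^ (s / 2)) ^ (2 / s) :=
        Real.rpow_le_rpow hqs hJ h2s.le
    _ = qcdPhaseQuenchedExpect β L mq (fun U => Y U ^ (2 : ℝ)) := by
        rw [← Real.rpow_mul hq2, show s / 2 * (2 / s) = 1 by field_simp, Real.rpow_one]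
    _ ≤ 144 * qcdPhaseQuenchedExpect β L mq Y2 := hCS.trans_eq hlin

/-- **Per-rate Jensen bridge at `N_f = 2`**: for each rate its own exponent `s ∈ (0,2]` and mass `m`. -/
theorem unsignedPin_two_of_fmPin_var :
    ∀ (reg : QCDRegularisation 2) (f : Fin 2), (∀ ε : ℝ, 0 < ε → ∃ s m : ℝ, 0 < s ∧ s ≤ 2 ∧ 0 < m ∧ ∀ C : ℝ, ∃ᶠ k in atTop, ∃ S : ℕ, reg.L k ≤ S ∧ ∃ n : ℕ, n ≤ S ∧ C * Real.exp (-(s * ε / 2 * (reg.a k * n))) < (∫ U : GaugeConfig 4 (2 * S + 1) (Matrix.specialUnitaryGroup (Fin 3) ℂ), ‖(diracMatrix U fun _ : Fin 2 => reg.mcrit k + reg.a k * m / reg.Zm k).det‖ * (∑ a : Fin 3, ∑ i : Fin 4, ∑ b : Fin 3, ∑ j : Fin 4, ‖(diracMatrix U fun _ : Fin 2 => reg.mcrit k + reg.a k * m / reg.Zm k)⁻¹ (quarkEquiv (f, (Torus.proj (2 * S + 1) 0, a, i))) (quarkEquiv (f, (Torus.proj (2 * S + 1) (Pi.single 0 (n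 : ℤ)), b, j)))‖) ^ s ∂(wilsonMeasure (fundamentalRep (Fin 3)) (reg.β k))) / (∫ U : GaugeConfig 4 (2 * S + 1) (Matrix.specialUnitaryGroup (Fin 3) ℂ), ‖(diracMatrix U fun _ : Fin 2 => reg.mcrit k + reg.a k * m / reg.Zm k).det‖ ∂(wilsonMeasure (fundamentalRep (Fin 3)) (reg.β k)))) → ∀ ε : ℝ, 0 < ε → ∃ m : ℝ, 0 < m ∧ ∀ C : ℝ, ∃ᶠ k in atTop, ∃ S : ℕ, reg.L k ≤ S ∧ ∃ n : ℕ, n ≤ S ∧ C * Real.exp (-(ε * (reg.a k * n))) < (∫ U : GaugeConfig 4 (2 * S + 1) (Matrix.specialUnitaryGroup (Fin 3) ℂ), ‖(diracMatrix U fun _ : Fin 2 => reg.mcrit k + reg.a k * m / reg.Zm k).det‖ * (∑ a : Fin 3, ∑ i : Fin 4, ∑ b : Fin 3, ∑ j : Fin 4, ‖(diracMatrix U fun _ : Fin 2 => reg.mcrit k + reg.a k * m / reg.Zm k)⁻¹ (quarkEquiv (f, (Torus.proj (2 * S + 1) 0, a, i))) (quarkEquiv (f, (Torus.proj (2 * S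 + 1) (Pi.single 0 (n : ℤ)), b, j)))‖ ^ (2 : ℕ)) ∂(wilsonMeasure (fundamentalRep (Fin 3)) (reg.β k))) / (∫ U : GaugeConfig 4 (2 * S + 1) (Matrix.specialUnitaryGroup (Fin 3) ℂ), ‖(diracMatrix U fun _ : Fin 2 => reg.mcrit k + reg.a k * m / reg.Zm k).det‖ ∂(wilsonMeasure (fundamentalRep (Fin 3)) (reg.β k))) := by
  intro reg f h ε hε
  obtain ⟨s, m, hs, hs2, hm, hC⟩ := h ε hε
  refine ⟨m, hm, fun C => ?_⟩
  set Cp : ℝ := max C 1 with hCp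
  have hCp0 : 0 < Cp := lt_of_lt_of_le one_pos (le_max_right _ _)
  refine (hC ((144 * Cp) ^ (s / 2))).mono fun k hk => ?_
  obtain ⟨S, hS, n, hn, hlt⟩ := hk
  refine ⟨S, hS, n, hn, ?_⟩
  have hpt := fm_rpow_le_secondMoment_two (2 * S + 1) (reg.β k) (reg.mcrit k + reg.a k * m / reg.Zm k) s hs hs2
    f (Torus.proj (2 * S + 1) 0) (Torus.proj (2 * S + 1) (Pi.single 0 (n : ℤ)))
  -- abbreviate the two quotients
  set FM : ℝ := (∫ U : GaugeConfig 4 (2 * S + 1) (Matrix.specialUnitaryGroup (Fin 3) ℂ),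
      ‖(diracMatrix U fun _ : Fin 2 => reg.mcrit k + reg.a k * m / reg.Zm k).det‖ *
        (∑ a : Fin 3, ∑ i : Fin 4, ∑ b : Fin 3, ∑ j : Fin 4,
          ‖(diracMatrix U fun _ : Fin 2 => reg.mcrit k + reg.a k * m / reg.Zm k)⁻¹
              (quarkEquiv (f, (Torus.proj (2 * S + 1) 0, a, i)))
              (quarkEquiv (f, (Torus.proj (2 * S + 1) (Pi.single 0 (n : ℤ)), b, j)))‖) ^ s
        ∂(wilsonMeasure (fundamentalRep (Fin 3)) (reg.β k))) /
      (∫ U : GaugeConfig 4 (2 * S + 1) (Matrix.specialUnitaryGroup (Fin 3) ℂ),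
        ‖(diracMatrix U fun _ : Fin 2 => reg.mcrit k + reg.a k * m / reg.Zm k).det‖
          ∂(wilsonMeasure (fundamentalRep (Fin 3)) (reg.β k))) with hFMdef
  set Q2 : ℝ := (∫ U : GaugeConfig 4 (2 * S + 1) (Matrix.specialUnitaryGroup (Fin 3) ℂ),
      ‖(diracMatrix U fun _ : Fin 2 => reg.mcrit k + reg.a k * m / reg.Zm k).det‖ *
        (∑ a : Fin 3, ∑ i : Fin 4, ∑ b : Fin 3, ∑ j : Fin 4,
          ‖(diracMatrix U fun _ : Fin 2 => reg.mcrit k + reg.a k * m / reg.Zm k)⁻¹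
              (quarkEquiv (f, (Torus.proj (2 * S + 1) 0, a, i)))
              (quarkEquiv (f, (Torus.proj (2 * S + 1) (Pi.single 0 (n : ℤ)), b, j)))‖ ^ (2 : ℕ))
        ∂(wilsonMeasure (fundamentalRep (Fin 3)) (reg.β k))) /
      (∫ U : GaugeConfig 4 (2 * S + 1) (Matrix.specialUnitaryGroup (Fin 3) ℂ),
        ‖(diracMatrix U fun _ : Fin 2 => reg.mcrit k + reg.a k * m / reg.Zm k).det‖
          ∂(wilsonMeasure (fundamentalRep (Fin 3)) (reg.β k))) with hQ2def
  change FM ^ (2 / s) ≤ 144 * Q2 at hpt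
  change (144 * Cp) ^ (s / 2) * Real.exp (-(s * ε / 2 * (reg.a k * n))) < FM at hlt
  change C * Real.exp (-(ε * (reg.a k * n))) < Q2
  have hbase : 0 ≤ 144 * Cp * Real.exp (-(ε * (reg.a k * n))) := by positivity
  have hexp : Real.exp (-(s * ε / 2 * (reg.a k * n))) = Real.exp (-(ε * (reg.a k * n))) ^ (s / 2) := by
    rw [← Real.exp_mul]; congr 1; ring
  have hlhs : (144 * Cp) ^ (s / 2) * Real.exp (-(s * ε / 2 * (reg.a k * n))) =
      (144 * Cp * Real.exp (-(ε * (reg.a k * n)))) ^ (s / 2) := by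
    rw [hexp, Real.mul_rpow (by positivity) (Real.exp_pos _).le]
  rw [hlhs] at hlt
  have h2s : 0 < 2 / s := by positivity
  -- undo the power `s/2` by applying `^(2/s)`
  have h1 : ((144 * Cp * Real.exp (-(ε * (reg.a k * n)))) ^ (s / 2)) ^ (2 / s) < FM ^ (2 / s) :=
    Real.rpow_lt_rpow (Real.rpow_nonneg hbase _) hlt h2s
  rw [← Real.rpow_mul hbase, show s / 2 * (2 / s) = 1 by field_simp, Real.rpow_one] at h1
  have h3 : 144 * Cp * Real.exp (-(ε * (reg.a k * n))) < 144 * Q2 := h1.trans_le hpt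
  have h4 : Cp * Real.exp (-(ε * (reg.a k * n))) < Q2 := by nlinarith [h3]
  calc C * Real.exp (-(ε * (reg.a k * n))) ≤ Cp * Real.exp (-(ε * (reg.a k * n))) :=
        mul_le_mul_of_nonneg_right (le_max_left _ _) (Real.exp_pos _).le
    _ < Q2 := h4

end Summit.QuantumFields.QCD.Cruxes.ChiralOneScaleTrajectory.GoldstoneWitness

end
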